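import Mathlib
import Literature.MathematicalPhysics.QuantumFieldTheory.Balaban1983to89.B14TentUnity
import Literature.MathematicalPhysics.QuantumFieldTheory.Balaban1983to89.TorusGeometry

/-!
# `Balaban1983to89.B14TentUnityTorus` — [Balaban1988Convergent] (3.40) p. 275 ON THE DISCRETE TORUS:
the tent decomposition of unity `Σ_z h_z = 1` for `x ∈ T₁^{(k)}`, `z ∈ T_L^{(k+1)}`, on the finite periodic
lattices `Setup.Site P j ⊃ emb (Site P (j+1))` — the periodization of `B14TentUnity.tentD_decomposition_unity`

statement-level skeleton of published theorems with citation tags; proofs where landed; nothing here is a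
claim about the Yang–Mills mass gap

PDF held: `paper:balaban1988-cmp119-convergent-renormalization` (journal page = PDF page + 242; display (3.40)
read on the x2 render p033 of `run/shared/lean/pub/pub-balaban/b2b-balaban-ref1/pages/1988-cmp119-…/`).

CITATION HEADER (lean-in-tree rule).  Source: T. Bałaban, *Convergent renormalization expansions for lattice gauge
theories*, Commun. Math. Phys. **119**, 243–285 (1988), doi:10.1007/bf01217741 [Balaban1988Convergent] (cell paper
B14).  Mega-formalization `lit-balaban` (HOME `run/shared/lean/pub/lit-balaban/`), Phase-2 proof seat p27
(unit `lit-balaban-p27`), SKELETON row **B14.Eq3.40** (decl of record `B14.TentUnity.tentD_decomposition_unity`,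
the identity on `ℤ^d`/`ℝ^d`; this file is its TORUS form, PHASE2-TARGETS.md §G.3 line p27).

THE PRINTED TEXT (verbatim, p. 275 [PDF 33]).  *"Next we introduce functions h_z on the lattice T₁^{(k)}, for
z ∈ T_L^{(k+1)}:  h_z(x) = Π_{μ=1}^{d} h(x_μ − z_μ),  h(t) = max{1 − L^{−1}|t|, 0}.  (3.40)  They form a
decomposition of unity: Σ_z h_z = 1."*

WHAT IS REPRODUCED (kernel-checked, no `sorry`, no axiom beyond the standard three).
* `tentZ L u` — the one-dimensional factor `h(x_μ − z_μ)` of (3.40) read on the discrete circle `ℤ/Nℤ`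
  (a coordinate of the torus `T^{(j)}` of `Setup`, `N = sitesPerDir j` sites per direction, lattice units):
  the difference `u = x_μ − z_μ ∈ ZMod N` enters through its representative of minimal absolute value
  (`ZMod.valMinAbs`, i.e. `|t|` = the distance on the circle), `h = B14Sect3.tent L`; `tentZ_eq_tent_min_val`
  rewrites it in the `Site.tdist` convention `min (u.val) ((−u).val)` of `Setup`.
* `tentT y x = Π_μ tentZ L (x μ − emb y μ)` — `h_z(x)` of (3.40) for `x ∈ Site P j` (= `T₁^{(k)}`) and the coarse
  centre `z = emb y`, `y ∈ Site P (j+1)` (= `T_L^{(k+1)} ⊂ T₁^{(k)}`, `Setup.emb`, B12's centred convention).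
* `tsum_tent_sub_mul_eq_tentZ` — PERIODIZATION: for `2L ≤ N` and every integer `t`,
  `Σ_{q∈ℤ} h(t − Nq) = tentZ L (t mod N)` (at most one translate of the tent of half-width `L` is non-zero).
* `sum_tentZ_sub_eq_one` — the one-dimensional torus decomposition of unity: for `N = M·L` with `M ≥ 2` coarse
  points, any offset `c`, and every `a ∈ ZMod N`, `Σ_{b ∈ ZMod M} tentZ L (a − (bL + c)) = 1`; PROOF = the printed
  route: the `ℤ`-identity `Σ_{z∈ℤ} h(x − Lz) = 1` (`B14Sect3.tent_partition_unity`) regrouped along the residues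
  `z = b + Mq` (`Equiv.tsum_eq`, `Summable.tsum_prod'`) and periodized fibrewise.
* `tentT_decomposition_unity` — **(3.40) "Σ_z h_z = 1" on the torus**: in the standing range `j + 1 ≤ m + K`
  (so that `sitesPerDir j = L · sitesPerDir (j+1)`; the guard "≥ 2 coarse points per direction" is automatic,
  `sitesPerDir (j+1) = 2L^{m+K-j-1} ≥ 2`), for every `x ∈ Site P j`: `Σ_{y ∈ Site P (j+1)} tentT y x = 1`
  (product over the coordinates, `Fintype.prod_sum`).  Out of the standing range the identity is FALSE
  (both tori degenerate to 2 sites per direction and the sum is `(2 − 1/L)^d`), hence the hypothesis —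
  kernel-checked in v1.1: `sum_tentT_of_le` (`m + K ≤ j → Σ_y tentT y x = (2 − 1/L)^d`) and
  `sum_tentT_ne_one_of_le`.
* `weightedAction_decomposition_torus` — the instance of (3.65) p. 283 (`B14.TentUnity.weightedAction_decomposition`)
  with the torus family `h_z = tentT z`: `A(φ, U) = Σ_{z ∈ Site P (j+1)} A(h_z φ, U)` for plaquette weights
  indexed by initial points in `Site P j`.
Nothing else of Sect. 3 is asserted here.
-/

open scoped BigOperators

namespace Literature.MathematicalPhysics.QuantumFieldTheory.Balaban1983to89.B14.TentUnityTorus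

open Literature.MathematicalPhysics.QuantumFieldTheory.Balaban1983to89

/-! ## The tent (3.40) on a discrete circle and on the torus `T^{(j)}` -/

/-- **(3.40) p. 275**, the one-dimensional factor `h(x_μ − z_μ)`, `h(t) = max{1 − L⁻¹|t|, 0}`, read on the discrete
circle `ℤ/Nℤ` (one coordinate of the torus): the class `u = x_μ − z_μ` enters through its representative of minimal
absolute value `ZMod.valMinAbs u ∈ (−N/2, N/2]`, so `|t|` is the distance on the circle (lattice units).
[cite: Balaban1988Convergent, (3.40) p.275] -/
noncomputable def tentZ (L : ℝ) {N : ℕ} (u : ZMod N) : ℝ :=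
  B14Sect3.tent L ((ZMod.valMinAbs u : ℤ) : ℝ)

/-- **(3.40) p. 275**: `h_z(x) = Π_{μ=1}^{d} h(x_μ − z_μ)` for `x ∈ T₁^{(k)} = Site P j` and the coarse centre
`z = emb y`, `y ∈ T_L^{(k+1)} = Site P (j+1)` (block size `L = P.L`, `Setup.emb` the inclusion of the coarse torus).
[cite: Balaban1988Convergent, (3.40) p.275] -/
noncomputable def tentT {P : Params} {j : ℕ} (y : Site P (j + 1)) (x : Site P j) : ℝ :=
  ∏ μ, tentZ (P.L : ℝ) (x μ - emb y μ)

/-- `h ≥ 0` on the circle (each tent is a `max{·, 0}`). [cite: Balaban1988Convergent, (3.40) p.275] -/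
theorem tentZ_nonneg (L : ℝ) {N : ℕ} (u : ZMod N) : 0 ≤ tentZ L u := by
  unfold tentZ B14Sect3.tent; exact le_max_right _ _

/-- `h(0) = 1` on the circle. [cite: Balaban1988Convergent, (3.40) p.275] -/
theorem tentZ_zero (L : ℝ) (N : ℕ) : tentZ L (0 : ZMod N) = 1 := by
  simp [tentZ, B14Sect3.tent]

/-- `h` is even on the circle: `h(z_μ − x_μ) = h(x_μ − z_μ)`. [cite: Balaban1988Convergent, (3.40) p.275] -/
theorem tentZ_neg (L : ℝ) {N : ℕ} (u : ZMod N) : tentZ L (-u) = tentZ L u := by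
  unfold tentZ B14Sect3.tent
  congr 2
  rw [← Int.cast_abs, ← Int.cast_abs, Int.abs_eq_natAbs, Int.abs_eq_natAbs, ZMod.natAbs_valMinAbs_neg]

/-- The same tent in the `Site.tdist` convention of `Setup`: `|x_μ − z_μ|` on the circle is
`min (u.val) ((−u).val)` (`= |valMinAbs u|`, Mathlib `ZMod.valMinAbs_natAbs_eq_min`), so
`tentZ L u = h(min (u.val) ((−u).val))`. [cite: Balaban1988Convergent, (3.40) p.275] -/
theorem tentZ_eq_tent_min_val (L : ℝ) {N : ℕ} [NeZero N] (u : ZMod N) :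
    tentZ L u = B14Sect3.tent L ((min u.val (-u).val : ℕ) : ℝ) := by
  unfold tentZ B14Sect3.tent
  congr 2
  rw [Nat.abs_cast, ← Int.cast_abs, Int.abs_eq_natAbs, ZMod.valMinAbs_natAbs_eq_min, Int.cast_natCast,
    ZMod.neg_val]
  split_ifs with h
  · subst h; simp
  · rfl

/-- `h_z ≥ 0` on the torus. [cite: Balaban1988Convergent, (3.40) p.275] -/
theorem tentT_nonneg {P : Params} {j : ℕ} (y : Site P (j + 1)) (x : Site P j) : 0 ≤ tentT y x :=
  Finset.prod_nonneg fun _ _ => tentZ_nonneg _ _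

/-! ## Periodization of the one-dimensional tent -/

/-- PERIODIZATION of the tent of (3.40): for `0 < L`, `2L ≤ N` and every integer `t`,
`Σ_{q ∈ ℤ} h(t − N q) = h(r)` where `r` is the representative of `t mod N` of minimal absolute value — at most the
translate `q₀` with `t − N q₀ = r ∈ (−N/2, N/2]` is non-zero, all others sit at distance `≥ N − N/2 ≥ L` from `0`.
[cite: Balaban1988Convergent, (3.40) p.275] -/
theorem tsum_tent_sub_mul_eq_tentZ (L : ℝ) (hL : 0 < L) (N : ℕ) [NeZero N] (hN : 2 * L ≤ (N : ℝ)) (t : ℤ) :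
    ∑' q : ℤ, B14Sect3.tent L ((t : ℝ) - N * q) = tentZ L (t : ZMod N) := by
  obtain ⟨q₀, hq₀⟩ : ∃ q₀ : ℤ, t = ((t : ZMod N)).valMinAbs + N * q₀ := by
    have h : (((t - ((t : ZMod N)).valMinAbs : ℤ)) : ZMod N) = 0 := by
      rw [Int.cast_sub, ZMod.coe_valMinAbs, sub_self]
    obtain ⟨q₀, hq⟩ := (ZMod.intCast_zmod_eq_zero_iff_dvd _ N).1 h
    exact ⟨q₀, by linarith⟩
  set r : ℤ := ((t : ZMod N)).valMinAbs with hr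
  have hr2 : 2 * |(r : ℝ)| ≤ N := by
    obtain ⟨h1, h2⟩ := ZMod.valMinAbs_mem_Ioc (t : ZMod N)
    have h1' : -(N : ℝ) < r * 2 := by exact_mod_cast h1
    have h2' : (r : ℝ) * 2 ≤ N := by exact_mod_cast h2
    have : |(r : ℝ)| ≤ N / 2 := abs_le.mpr ⟨by linarith, by linarith⟩
    linarith
  rw [tsum_eq_single q₀]
  · unfold tentZ
    rw [← hr]
    congr 1
    rw [hq₀]; push_cast; ring
  · intro q hq
    apply B14Sect3.tent_eq_zero_of_le L _ hL
    have hk : (1 : ℝ) ≤ |((q₀ - q : ℤ) : ℝ)| := by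
      rw [← Int.cast_abs]; exact_mod_cast Int.one_le_abs (sub_ne_zero.mpr (Ne.symm hq))
    have heq : (t : ℝ) - N * q = r + N * ((q₀ - q : ℤ) : ℝ) := by
      rw [hq₀]; push_cast; ring
    rw [heq]
    have hNk : (N : ℝ) ≤ |(N : ℝ) * ((q₀ - q : ℤ) : ℝ)| := by
      rw [abs_mul, Nat.abs_cast]
      exact le_mul_of_one_le_right (Nat.cast_nonneg N) hk
    have h3 : |(N : ℝ) * ((q₀ - q : ℤ) : ℝ)| - |(r : ℝ)| ≤ |(r : ℝ) + N * ((q₀ - q : ℤ) : ℝ)| := by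
      have := abs_sub_abs_le_abs_sub ((N : ℝ) * ((q₀ - q : ℤ) : ℝ)) (-(r : ℝ))
      rwa [abs_neg, sub_neg_eq_add, add_comm] at this
    linarith

/-! ## Regrouping `ℤ` along the residues modulo `M` -/

/-- Plumbing: `ZMod M × ℤ ≃ ℤ`, `(b, q) ↦ b + M q` (`b` read through its canonical representative `b.val`), inverse
`z ↦ (z mod M, ⌊z/M⌋)` — the regrouping of the `ℤ`-sum of the tents along residue classes. [folklore] -/
def residueEquiv (M : ℕ) [NeZero M] : ZMod M × ℤ ≃ ℤ where
  toFun p := (p.1.val : ℤ) + M * p.2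
  invFun z := ((z : ZMod M), z / M)
  left_inv p := by
    obtain ⟨b, q⟩ := p
    have hM : (M : ℤ) ≠ 0 := by exact_mod_cast NeZero.ne M
    refine Prod.ext ?_ ?_
    · show ((((b.val : ℤ) + M * q : ℤ)) : ZMod M) = b
      rw [Int.cast_add, Int.cast_mul, Int.cast_natCast, Int.cast_natCast, ZMod.natCast_zmod_val,
        ZMod.natCast_self, zero_mul, add_zero]
    · show ((b.val : ℤ) + M * q) / M = q
      rw [Int.add_mul_ediv_left _ _ hM,
        Int.ediv_eq_zero_of_lt (by positivity) (by exact_mod_cast ZMod.val_lt b), zero_add]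
  right_inv z := by
    show ((((z : ZMod M)).val : ℤ)) + M * (z / M) = z
    rw [ZMod.val_intCast, Int.emod_add_mul_ediv]

/-- Unfolding of the plumbing equivalence `residueEquiv`: `(b, q) ↦ b.val + M q`. [folklore] -/
private theorem residueEquiv_apply (M : ℕ) [NeZero M] (b : ZMod M) (q : ℤ) :
    residueEquiv M (b, q) = (b.val : ℤ) + M * q := rfl

/-! ## (3.40) on one discrete circle -/

/-- The one-dimensional torus decomposition of unity behind (3.40): on the circle `ℤ/Nℤ`, `N = M·L`, with `M ≥ 2`
coarse points `bL + c` (`b ∈ ℤ/Mℤ`, any offset `c`), `Σ_{b} h(a − (bL + c)) = 1` for every `a ∈ ℤ/Nℤ`.  Proof as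
printed ("decomposition of unity"): the identity `Σ_{z∈ℤ} h(x − Lz) = 1` on `ℤ` (`B14Sect3.tent_partition_unity`,
`x = a − c`) regrouped along `z = b + Mq` and periodized fibrewise (`tsum_tent_sub_mul_eq_tentZ`, `2L ≤ N`).
[cite: Balaban1988Convergent, (3.40) p.275] -/
theorem sum_tentZ_sub_eq_one (L M : ℕ) [NeZero M] (hL : 0 < L) (hM : 2 ≤ M) (N : ℕ) [NeZero N]
    (hN : N = M * L) (c : ℕ) (a : ZMod N) :
    ∑ b : ZMod M, tentZ (L : ℝ) (a - ((b.val * L + c : ℕ) : ZMod N)) = 1 := by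
  have hLr : (0 : ℝ) < L := Nat.cast_pos.mpr hL
  have hNr : (N : ℝ) = M * L := by rw [hN]; push_cast; ring
  have hNL : 2 * (L : ℝ) ≤ N := by
    rw [hNr]
    exact mul_le_mul_of_nonneg_right (by exact_mod_cast hM) hLr.le
  set x : ℝ := (a.val : ℝ) - c with hx
  set f : ℤ → ℝ := fun z => B14Sect3.tent L (x - L * z) with hf
  have hunity : ∑' z, f z = 1 := B14Sect3.tent_partition_unity L x hLr
  have hfs : Summable f :=
    summable_of_ne_finset_zero (s := TentUnity.window (L : ℝ) x)
      (fun z hz => TentUnity.tent_eq_zero_off_window (L : ℝ) x hLr z hz)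
  set e : ZMod M × ℤ ≃ ℤ := residueEquiv M with he
  have key : ∀ (b : ZMod M) (q : ℤ),
      f (e (b, q)) = B14Sect3.tent L ((((a.val : ℤ) - (b.val * L + c : ℕ) : ℤ) : ℝ) - N * q) := by
    intro b q
    rw [he, residueEquiv_apply, hf]
    show B14Sect3.tent L (x - L * (((b.val : ℤ) + M * q : ℤ) : ℝ)) = _
    congr 1
    rw [hx, hNr]; push_cast; ring
  have hinj : ∀ b : ZMod M, Function.Injective fun q : ℤ => e (b, q) := by
    intro b q q' h
    have h' := e.injective h
    simpa using h'
  have h3 : ∀ b : ZMod M,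
      ∑' q : ℤ, f (e (b, q)) = tentZ (L : ℝ) (a - ((b.val * L + c : ℕ) : ZMod N)) := by
    intro b
    simp_rw [key]
    rw [tsum_tent_sub_mul_eq_tentZ (L : ℝ) hLr N hNL ((a.val : ℤ) - (b.val * L + c : ℕ))]
    congr 1
    rw [Int.cast_sub, Int.cast_natCast, Int.cast_natCast, ZMod.natCast_zmod_val]
  calc ∑ b : ZMod M, tentZ (L : ℝ) (a - ((b.val * L + c : ℕ) : ZMod N))
      = ∑ b : ZMod M, ∑' q : ℤ, f (e (b, q)) := Finset.sum_congr rfl fun b _ => (h3 b).symm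
    _ = ∑' b : ZMod M, ∑' q : ℤ, f (e (b, q)) := (tsum_fintype _).symm
    _ = ∑' p : ZMod M × ℤ, f (e p) :=
        (Summable.tsum_prod' (hfs.comp_injective e.injective) fun b => hfs.comp_injective (hinj b)).symm
    _ = ∑' z, f z := Equiv.tsum_eq e f
    _ = 1 := hunity

/-! ## (3.40) on the torus `T^{(j)}` -/

/-- **(3.40) p. 275, "They form a decomposition of unity: Σ_z h_z = 1"**, on the discrete torus: in the standing
range `j + 1 ≤ m + K` of `Setup` (where `T^{(j)}` has `L` times as many sites per direction as `T^{(j+1)}`, and the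
coarse torus has `2L^{m+K-j-1} ≥ 2` sites per direction), for every `x ∈ Site P j`,
`Σ_{y ∈ Site P (j+1)} Π_μ h(x_μ − (emb y)_μ) = 1`.  Product over the coordinates of `sum_tentZ_sub_eq_one`
(`emb y = yL + (L−1)/2`, `TorusGeometry`/`Setup`). [cite: Balaban1988Convergent, (3.40) p.275] -/
theorem tentT_decomposition_unity {P : Params} {j : ℕ} (hj : j + 1 ≤ P.m + P.K) (x : Site P j) :
    ∑ y : Site P (j + 1), tentT y x = 1 := by
  classical
  set g : Fin P.d → ZMod (P.sitesPerDir (j + 1)) → ℝ := fun μ b =>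
    tentZ (P.L : ℝ) (x μ - (((b.val * P.L + (P.L - 1) / 2 : ℕ)) : ZMod (P.sitesPerDir j))) with hg
  have hsummand : ∀ y : Site P (j + 1), tentT y x = ∏ μ, g μ (y μ) := fun y => rfl
  have hg1 : ∀ μ, ∑ b, g μ b = 1 := fun μ =>
    sum_tentZ_sub_eq_one P.L (P.sitesPerDir (j + 1)) P.L_pos (P.one_lt_sitesPerDir (j + 1))
      (P.sitesPerDir j) (P.sitesPerDir_eq_mul_succ hj) ((P.L - 1) / 2) (x μ)
  calc ∑ y : Site P (j + 1), tentT y x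
      = ∑ y : Fin P.d → ZMod (P.sitesPerDir (j + 1)), ∏ μ, g μ (y μ) :=
        Finset.sum_congr rfl fun y _ => hsummand y
    _ = ∏ μ, ∑ b, g μ b := (Fintype.prod_sum g).symm
    _ = 1 := Finset.prod_eq_one fun μ _ => hg1 μ

/-! ## (3.65) with the torus tents -/

/-- **(3.65) p. 283 with the tents (3.40) of the torus**: for the weighted Wilson action
`A(ψ, U) = Σ_p ψ(x(p))·w(p)` (`B14Seam245.weightedAction`, p. 253) with plaquettes labelled by initial points
`x(p) ∈ Site P j`, `A(φ, U) = Σ_{z ∈ Site P (j+1)} A(h_z φ, U)` — `B14.TentUnity.weightedAction_decomposition` fed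
with the decomposition of unity `tentT_decomposition_unity`. [cite: Balaban1988Convergent, (3.65) p.283] -/
theorem weightedAction_decomposition_torus {P : Params} {j : ℕ} (hj : j + 1 ≤ P.m + P.K) {Pl : Type*}
    (plaq : Finset Pl) (x : Pl → Site P j) (w : Pl → ℝ) (φ : Site P j → ℝ) :
    B14Seam245.weightedAction plaq x w φ =
      ∑ z : Site P (j + 1), B14Seam245.weightedAction plaq x w (fun y => tentT z y * φ y) :=
  TentUnity.weightedAction_decomposition plaq x w φ Finset.univ (fun z y => tentT z y)
    fun p _ => tentT_decomposition_unity hj (x p)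

/-! ## v1.1 — the standing-range hypothesis of `tentT_decomposition_unity` is necessary

Kernel remark (seat p27, same row B14.Eq3.40): out of the standing range, `m + K ≤ j`, both `Site P j` and
`Site P (j+1)` have `sitesPerDir = 2·L⁰ = 2` sites per direction, the two coarse centres `bL + (L−1)/2`, `b = 0, 1`,
are the two DISTINCT points of each circle (`L` odd), and `Σ_y h_y(x) = Π_μ (h(0) + h(1)) = (2 − 1/L)^d ≠ 1`.
So the guard `j + 1 ≤ m + K` ("at least two coarse points per direction AND `N = L·M`") cannot be dropped. -/

/-- Out of the standing range the tori degenerate to two sites per direction: `sitesPerDir j = 2·L⁰ = 2`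
(cf. `AveragingRT.sitesPerDir_of_le`; restated privately to keep the imports light). [folklore] -/
private theorem sitesPerDir_eq_two {P : Params} {j : ℕ} (hj : P.m + P.K ≤ j) : P.sitesPerDir j = 2 := by
  unfold Params.sitesPerDir
  rw [show P.m + P.K - j = 0 by omega, pow_zero, mul_one]

/-- On the two-point circle `ℤ/2ℤ` with the two coarse points `bL + c`, `b ∈ ℤ/2ℤ`, `L` odd and `> 1`, the tents of
(3.40) sum to `h(0) + h(1) = 2 − 1/L`. [folklore] -/
private theorem sum_tentZ_two (L M N : ℕ) [NeZero M] [NeZero N] (hL : Odd L ∧ 1 < L) (hM : M = 2) (hN : N = 2)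
    (c : ℕ) (a : ZMod N) :
    ∑ b : ZMod M, tentZ (L : ℝ) (a - ((b.val * L + c : ℕ) : ZMod N)) = 2 - (L : ℝ)⁻¹ := by
  obtain ⟨k, hk⟩ := hL.1
  -- the two coarse points are distinct: `b ↦ a − (bL + c)` is a bijection `ℤ/Mℤ → ℤ/Nℤ`
  have hinj : Function.Injective fun b : ZMod M => a - ((b.val * L + c : ℕ) : ZMod N) := by
    intro b b' h
    have h' : ((b.val * L + c : ℕ) : ZMod N) = ((b'.val * L + c : ℕ) : ZMod N) := by
      simpa only [sub_right_inj] using h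
    rw [ZMod.natCast_eq_natCast_iff', hN] at h'
    apply ZMod.val_injective
    have hb : b.val < 2 := hM ▸ ZMod.val_lt b
    have hb' : b'.val < 2 := hM ▸ ZMod.val_lt b'
    rcases (show b.val = 0 ∨ b.val = 1 by omega) with h0 | h0 <;>
      rcases (show b'.val = 0 ∨ b'.val = 1 by omega) with h1 | h1 <;>
      rw [h0, h1] at h' ⊢ <;> omega
  have hbij : Function.Bijective fun b : ZMod M => a - ((b.val * L + c : ℕ) : ZMod N) := by
    rw [Fintype.bijective_iff_injective_and_card]
    exact ⟨hinj, by simp [ZMod.card, hM, hN]⟩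
  rw [hbij.sum_comp (fun u : ZMod N => tentZ (L : ℝ) u)]
  -- enumerate `ℤ/Nℤ`, `N = 2`, through `Fin 2`
  have hbij2 : Function.Bijective fun i : Fin 2 => ((i : ℕ) : ZMod N) := by
    rw [Fintype.bijective_iff_injective_and_card]
    refine ⟨fun i i' h => ?_, by simp [ZMod.card, hN]⟩
    have h' := (ZMod.natCast_eq_natCast_iff' _ _ _).1 h
    rw [hN, Nat.mod_eq_of_lt i.isLt, Nat.mod_eq_of_lt i'.isLt] at h'
    exact Fin.ext h'
  rw [← hbij2.sum_comp (fun u : ZMod N => tentZ (L : ℝ) u), Fin.sum_univ_two]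
  have h0 : tentZ (L : ℝ) (((0 : Fin 2) : ℕ) : ZMod N) = 1 := by
    rw [Fin.val_zero, Nat.cast_zero]; exact tentZ_zero _ _
  have h1 : tentZ (L : ℝ) (((1 : Fin 2) : ℕ) : ZMod N) = 1 - (L : ℝ)⁻¹ := by
    have hv : (((1 : ℕ) : ZMod N)).valMinAbs = 1 := ZMod.valMinAbs_natCast_of_le_half (by rw [hN])
    rw [Fin.val_one, tentZ, hv]
    unfold B14Sect3.tent
    have hL1 : (1 : ℝ) < L := by exact_mod_cast hL.2
    rw [Int.cast_one, abs_one, one_div, max_eq_left]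
    rw [sub_nonneg]
    exact inv_le_one_of_one_le₀ hL1.le
  rw [h0, h1]; ring

/-- The standing-range hypothesis of `tentT_decomposition_unity` cannot be dropped: for `m + K ≤ j` (both tori with
two sites per direction) and every `x ∈ Site P j`, `Σ_{y ∈ Site P (j+1)} h_y(x) = (2 − 1/L)^d`.
[cite: Balaban1988Convergent, (3.40) p.275] -/
theorem sum_tentT_of_le {P : Params} {j : ℕ} (hj : P.m + P.K ≤ j) (x : Site P j) :
    ∑ y : Site P (j + 1), tentT y x = (2 - (P.L : ℝ)⁻¹) ^ P.d := by
  classical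
  set g : Fin P.d → ZMod (P.sitesPerDir (j + 1)) → ℝ := fun μ b =>
    tentZ (P.L : ℝ) (x μ - (((b.val * P.L + (P.L - 1) / 2 : ℕ)) : ZMod (P.sitesPerDir j))) with hg
  have hsummand : ∀ y : Site P (j + 1), tentT y x = ∏ μ, g μ (y μ) := fun y => rfl
  have hg1 : ∀ μ, ∑ b, g μ b = 2 - (P.L : ℝ)⁻¹ := fun μ =>
    sum_tentZ_two P.L (P.sitesPerDir (j + 1)) (P.sitesPerDir j) P.hL (sitesPerDir_eq_two (by omega))
      (sitesPerDir_eq_two hj) ((P.L - 1) / 2) (x μ)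
  calc ∑ y : Site P (j + 1), tentT y x
      = ∑ y : Fin P.d → ZMod (P.sitesPerDir (j + 1)), ∏ μ, g μ (y μ) :=
        Finset.sum_congr rfl fun y _ => hsummand y
    _ = ∏ μ, ∑ b, g μ b := (Fintype.prod_sum g).symm
    _ = ∏ _μ : Fin P.d, (2 - (P.L : ℝ)⁻¹) := Finset.prod_congr rfl fun μ _ => hg1 μ
    _ = (2 - (P.L : ℝ)⁻¹) ^ P.d := by rw [Finset.prod_const, Finset.card_univ, Fintype.card_fin]

/-- … and `(2 − 1/L)^d ≠ 1` (`L > 1`, `d ≥ 1`): out of the standing range the torus tents of (3.40) do NOT form a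
decomposition of unity. [cite: Balaban1988Convergent, (3.40) p.275] -/
theorem sum_tentT_ne_one_of_le {P : Params} {j : ℕ} (hj : P.m + P.K ≤ j) (x : Site P j) :
    ∑ y : Site P (j + 1), tentT y x ≠ 1 := by
  rw [sum_tentT_of_le hj x]
  have hL1 : (1 : ℝ) < P.L := by exact_mod_cast P.hL.2
  have hgt : (1 : ℝ) < 2 - (P.L : ℝ)⁻¹ := by
    have : (P.L : ℝ)⁻¹ < 1 := inv_lt_one_of_one_lt₀ hL1
    linarith
  exact (one_lt_pow₀ hgt (by have := P.hd; omega)).ne'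

end Literature.MathematicalPhysics.QuantumFieldTheory.Balaban1983to89.B14.TentUnityTorus
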